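import Literature.NumberTheory.Automorphic.ArchRankOneOrbitalFamilyParamCayley     -- ★ p851143 (this seat): frame (0) `nonempty_isComplex_infinitePlace_complex`, `exists_cayley_transport`, `contDiffOn_cayley_orbitalIntegral_param`; brings ★ (ELL-∞-UNIF) `ArchRankOneCasimirUniform`
import Literature.NumberTheory.Automorphic.ArchLocalRelabelTransport               -- ★ `isMulRightInvariant_map_continuousMulEquiv` (right invariance transports along `≃ₜ*`)
import HarnessLib

/-!
# (ELL-∞-UNIF) ON THE SHARED-DATUM CARRIER `U(J)`, `J = Φ₂`, CAYLEY TORUS — and on a FIXED punctured interval: for `g ∈ C_c^∞(M₂(ℂ), E′)` ONE constant `B` with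
# `‖∂_ψⁿ F(ℓ ∘ g)(ψ)‖ ≤ ‖ℓ‖ · B` for ALL `0 < |ψ| ≤ ½` and ALL `ℓ : E′ →L E` (Varadarajan 1989 §6.4 Thms 22–24; Bouaziz 1994 §3.1 (I₂) «toutes ses dérivées y sont bornées»)

Topic `NumberTheory/Automorphic`; namespace `Literature.NumberTheory.Automorphic.UnitaryGroup`.  THEOREMS ONLY (no `def`, no instance, no notation, no axiom, no named fact, no `sorry`);
kernel lane `--kind proof --supports stmt-HodgeConjecture-24833`.  Cell `pub/hodgecm-mathlib`, crux H413 (`stmt-HodgeConjecture-24833`), line LH3 (closer stub `stub_N9`), LETTER L1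
clause (I₁) at the X′-CORNERS (organ O-L1e of leaf v5), brick **(X3-rk1) (i)** «the FIXED-INTERVAL `hunif` at `E′`» (F0P3a-p02 (g21)'s split 2026-09-02T11:00:14Z under LH3-plan (g4)
RULING #18; author F0P3a-p04 (g24)); consumer: ★ `exists_forall_norm_iteratedDeriv_le_of_uniform_bounds_on` (F0P3a-p02, `ArchOrbFamGExtCornerReaders` §2) whose `hunif` is a bound on
a FIXED set `T₀` (the corner calculus is filter-free), read at `E′ := ℓ^∞(J′, E)`.

THE MATHEMATICS.  The carrier is the shared datum's `U(J) = unitaryGroupOfForm (starRingEnd ℂ) J`, `hJ : J = (StdForm.antidiagonal 2).over ℂ`, with the CAYLEY torus arc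
`h · P t_z(ψ) P⁻¹ · h⁻¹` (★ (K0±) p850353 ∕ ★ (B-desc) ∕ ★ p851143 text), `μ` a Haar measure, right invariant.  Along the Cayley congruence `e : U(σ_{w₀} diag(2,−2))(ℂ) ≃ₜ* U(J)`
(★ p851143 `exists_cayley_transport`, `w₀` a complex place of the field `ℂ`; `μ.map e⁻¹` is again Haar and right invariant) the functional is the ENGINE's functional of the transported
test function `X ↦ g(P X P⁻¹)` (★ `integral_comp_conj_transport`), so the ★ (ELL-∞)∕(ELL-∞-UNIF) heads of `ArchRankOneCasimirUniform` transfer VERBATIM (engine side conditions at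
`a = (2, −2)`, `p = q = 1`; the Casimir `Ω′` built in-proof from its defining formula):
* §1 `engineFrame_complex` (side conditions), **`cayley_orbitalIntegral_comp_clm_of_eq_over`** (`F(ℓ ∘ g) ψ = ℓ(F′ g ψ)`, all `ψ`; `μ` finite on compacts),
  **`contDiffOn_cayley_orbitalIntegral_punctured_of_eq_over`** (`F f ∈ C^∞(Ioo (−1) 1 ∖ {0})`; from ★ p851143 with the constant family — `μ` finite on compacts),
  **`iteratedDeriv_cayley_orbitalIntegral_comp_clm_of_eq_over`** (jets commute with `ℓ` off the wall).
* §2 **`exists_forall_eventually_norm_iteratedDeriv_cayley_orbitalIntegral_comp_clm_le_of_eq_over`** — ★ (ELL-∞-UNIF) §4 on `U(J)`: `∃ B ≥ 0, ∀ᶠ ψ in 𝓝[≠] 0, ∀ ℓ,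
  ‖∂ⁿ F(ℓ∘g)(ψ)‖ ≤ ‖ℓ‖·B`.
* §3 HEAD **`exists_forall_norm_iteratedDeriv_cayley_orbitalIntegral_comp_clm_le_of_mem_Icc`** — the FIXED punctured interval: `∃ B, ∀ ψ ∈ Icc (−½) ½ ∖ {0}, ∀ ℓ, ‖∂ⁿ F(ℓ∘g)(ψ)‖ ≤ ‖ℓ‖·B`
  (§2 near `0`; away from `0` the `E′`-jet `∂ⁿ F′ g` is continuous on a compact annulus (§1), and `∂ⁿ F(ℓ∘g) = ℓ ∘ ∂ⁿ F′ g` there).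
HONEST LABEL: HC_CM is proved only modulo the 7 printed citations (2 remaining named inputs: hLiu418 = `stmt-HodgeConjecture-24832`, h413 = `stmt-HodgeConjecture-24833`) until rung 0
closes; frame bookkeeping over ★ (ELL-∞-UNIF), count-neutral (letter-L1 (I₁)-corner brick; pays nothing by itself).

## References
* [Varadarajan1989] V. S. Varadarajan, *An Introduction to Harmonic Analysis on Semisimple Lie Groups*, Cambridge Stud. Adv. Math. 16 (1989), §6.4 Thms 22–24.
* [Bouaziz1994IntegralesOrbitales] A. Bouaziz, *Intégrales orbitales sur les groupes de Lie réductifs*, Ann. Sci. ÉNS 27 (1994), §3.1 (I₁)–(I₂) p. 579.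
* [Rogawski1990] J. D. Rogawski, *Automorphic Representations of Unitary Groups in Three Variables*, Ann. of Math. Stud. 123 (1990), §8.2 pp. 119–123 (the Cayley frame).
* [PlatonovRapinchuk1994] V. Platonov, A. Rapinchuk, *Algebraic Groups and Number Theory* (1994), §2.3.
-/

set_option autoImplicit false

noncomputable section

namespace Literature.NumberTheory.Automorphic

namespace UnitaryGroup

open _root_.MeasureTheory _root_.MeasureTheory.Measure _root_.Set _root_.Filter _root_.Topology _root_.Complex _root_.NumberField _root_.NumberField.InfinitePlace
open _root_.Literature.Analysis.Calculus _root_.Literature.NumberTheory.Automorphic.RankOneCasimir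
open scoped MatrixGroups ContDiff ComplexConjugate
open scoped Matrix.Norms.Operator

/-! ## §1 Frame, the CLM commutation, smoothness off the wall -/

/-- **The engine's side conditions at the `L := ℂ` instance `a = (2, −2)`, `p = q = 1`**: `a_i ≠ 0`, `σ_{w₀}(a_i)` real, `re σ(2) · re σ(−2) < 0`, `1² · σ(−2) = −σ(2)`.
[cite: Rogawski1990, §8.2 p. 122] -/
theorem engineFrame_complex (w₀ : {w : InfinitePlace ℂ // IsComplex w}) :
    (∀ i, (![(2 : ℂ), -2]) i ≠ 0) ∧ (∀ i, ((w₀.1.embedding : ℂ →+* ℂ) ((![(2 : ℂ), -2]) i)).im = 0) ∧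
      ((w₀.1.embedding : ℂ →+* ℂ) ((![(2 : ℂ), -2]) 0)).re * ((w₀.1.embedding : ℂ →+* ℂ) ((![(2 : ℂ), -2]) 1)).re < 0 ∧
      ((1 : ℝ) : ℂ) ^ 2 * (w₀.1.embedding : ℂ →+* ℂ) ((![(2 : ℂ), -2]) 1) = -(w₀.1.embedding : ℂ →+* ℂ) ((![(2 : ℂ), -2]) 0) := by
  have h0 : (w₀.1.embedding : ℂ →+* ℂ) ((![(2 : ℂ), -2]) 0) = 2 := by
    rw [show (![(2 : ℂ), -2]) 0 = 2 from rfl, map_ofNat]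
  have h1 : (w₀.1.embedding : ℂ →+* ℂ) ((![(2 : ℂ), -2]) 1) = -2 := by
    rw [show (![(2 : ℂ), -2]) 1 = -2 from rfl, map_neg, map_ofNat]
  refine ⟨fun i => by fin_cases i <;> simp, fun i => ?_, ?_, ?_⟩
  · fin_cases i
    · show ((w₀.1.embedding : ℂ →+* ℂ) ((![(2 : ℂ), -2]) 0)).im = 0
      rw [h0]; norm_num
    · show ((w₀.1.embedding : ℂ →+* ℂ) ((![(2 : ℂ), -2]) 1)).im = 0
      rw [h1]; norm_num
  · rw [h0, h1]; norm_num
  · rw [h0, h1]; norm_num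

variable {J : Matrix (Fin 2) (Fin 2) ℂ} (hJ : J = (StdForm.antidiagonal 2).over ℂ)
  [MeasurableSpace ↥(unitaryGroupOfForm (starRingEnd ℂ) J)] [BorelSpace ↥(unitaryGroupOfForm (starRingEnd ℂ) J)]
  {E : Type*} [NormedAddCommGroup E] [NormedSpace ℝ E] [CompleteSpace E]
  {E' : Type*} [NormedAddCommGroup E'] [NormedSpace ℝ E'] [CompleteSpace E']

include hJ in
/-- **`F(ℓ ∘ g)(ψ) = ℓ(F′ g ψ)` for EVERY `ψ`, `U(J)`-Cayley carrier** (`g` continuous with compact support, `μ` finite on compacts): ★ `RankOneCasimir.orbitalIntegral_comp_clm` transported along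
★ `exists_cayley_transport`. [cite: Varadarajan1989, §6.4] [cite: Rogawski1990, §8.2 p. 122] -/
theorem cayley_orbitalIntegral_comp_clm_of_eq_over (μ : Measure ↥(unitaryGroupOfForm (starRingEnd ℂ) J)) [IsFiniteMeasureOnCompacts μ] (z : Circle)
    (F : (Matrix (Fin 2) (Fin 2) ℂ → E) → ℝ → E)
    (hF : ∀ (f : Matrix (Fin 2) (Fin 2) ℂ → E) (ψ : ℝ), F f ψ = (2 * Real.sin ψ) •
      ∫ h : ↥(unitaryGroupOfForm (starRingEnd ℂ) J),
        f (((h * ⟨Matrix.GeneralLinearGroup.mkOfDetNeZero !![(1 : ℂ), 1; 1, -1] det_cayleyTwo_ne_zero *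
              circleDiagonal 2 ![z * Circle.exp ψ, z * Circle.exp (-ψ)] * (Matrix.GeneralLinearGroup.mkOfDetNeZero !![(1 : ℂ), 1; 1, -1] det_cayleyTwo_ne_zero)⁻¹,
            cayley_conj_circleDiagonal_mem_of_eq_over hJ _⟩ * h⁻¹ : ↥(unitaryGroupOfForm (starRingEnd ℂ) J)) : GL (Fin 2) ℂ) : Matrix (Fin 2) (Fin 2) ℂ) ∂μ)
    (F' : (Matrix (Fin 2) (Fin 2) ℂ → E') → ℝ → E')
    (hF' : ∀ (g : Matrix (Fin 2) (Fin 2) ℂ → E') (ψ : ℝ), F' g ψ = (2 * Real.sin ψ) •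
      ∫ h : ↥(unitaryGroupOfForm (starRingEnd ℂ) J),
        g (((h * ⟨Matrix.GeneralLinearGroup.mkOfDetNeZero !![(1 : ℂ), 1; 1, -1] det_cayleyTwo_ne_zero *
              circleDiagonal 2 ![z * Circle.exp ψ, z * Circle.exp (-ψ)] * (Matrix.GeneralLinearGroup.mkOfDetNeZero !![(1 : ℂ), 1; 1, -1] det_cayleyTwo_ne_zero)⁻¹,
            cayley_conj_circleDiagonal_mem_of_eq_over hJ _⟩ * h⁻¹ : ↥(unitaryGroupOfForm (starRingEnd ℂ) J)) : GL (Fin 2) ℂ) : Matrix (Fin 2) (Fin 2) ℂ) ∂μ)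
    (ℓ : E' →L[ℝ] E) {g : Matrix (Fin 2) (Fin 2) ℂ → E'} (hg : Continuous g) (hgc : HasCompactSupport g) (ψ : ℝ) :
    F (fun X => ℓ (g X)) ψ = ℓ (F' g ψ) := by
  obtain ⟨w₀⟩ := nonempty_isComplex_infinitePlace_complex
  letI : MeasurableSpace ↥(unitaryGroupOfForm (starRingEnd ℂ) ((Matrix.diagonal ![(2 : ℂ), -2]).map (w₀.1.embedding : ℂ →+* ℂ))) := borel _
  haveI : BorelSpace ↥(unitaryGroupOfForm (starRingEnd ℂ) ((Matrix.diagonal ![(2 : ℂ), -2]).map (w₀.1.embedding : ℂ →+* ℂ))) := ⟨rfl⟩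
  obtain ⟨e, he, hγ, htr⟩ := exists_cayley_transport (E := E) hJ w₀
  haveI : IsFiniteMeasureOnCompacts (μ.map e.symm) := IsFiniteMeasureOnCompacts.map μ e.symm.toHomeomorph
  obtain ⟨hα, -, -, -⟩ := engineFrame_complex w₀
  have htr' : ∀ (g' : Matrix (Fin 2) (Fin 2) ℂ → E') (u : Fin 2 → Circle),
      ∫ h : ↥(unitaryGroupOfForm (starRingEnd ℂ) J),
          g' (((h * ⟨Matrix.GeneralLinearGroup.mkOfDetNeZero !![(1 : ℂ), 1; 1, -1] det_cayleyTwo_ne_zero * circleDiagonal 2 u *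
                (Matrix.GeneralLinearGroup.mkOfDetNeZero !![(1 : ℂ), 1; 1, -1] det_cayleyTwo_ne_zero)⁻¹, cayley_conj_circleDiagonal_mem_of_eq_over hJ u⟩ * h⁻¹ :
              ↥(unitaryGroupOfForm (starRingEnd ℂ) J)) : GL (Fin 2) ℂ) : Matrix (Fin 2) (Fin 2) ℂ) ∂μ =
        ∫ h' : ↥(unitaryGroupOfForm (starRingEnd ℂ) ((Matrix.diagonal ![(2 : ℂ), -2]).map (w₀.1.embedding : ℂ →+* ℂ))),
          (fun X : Matrix (Fin 2) (Fin 2) ℂ => g' (((Matrix.GeneralLinearGroup.mkOfDetNeZero !![(1 : ℂ), 1; 1, -1] det_cayleyTwo_ne_zero : GL (Fin 2) ℂ) : Matrix (Fin 2) (Fin 2) ℂ) *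
              X * (((Matrix.GeneralLinearGroup.mkOfDetNeZero !![(1 : ℂ), 1; 1, -1] det_cayleyTwo_ne_zero)⁻¹ : GL (Fin 2) ℂ) : Matrix (Fin 2) (Fin 2) ℂ)))
            (((h' * ⟨circleDiagonal 2 u, circleDiagonal_mem_archLocal_diagonal ℂ 2 ![(2 : ℂ), -2] w₀ u⟩ * h'⁻¹ :
              ↥(unitaryGroupOfForm (starRingEnd ℂ) ((Matrix.diagonal ![(2 : ℂ), -2]).map (w₀.1.embedding : ℂ →+* ℂ)))) : GL (Fin 2) ℂ) : Matrix (Fin 2) (Fin 2) ℂ)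
          ∂(μ.map e.symm) := fun g' u => by
    rw [hγ u, integral_comp_conj_transport _ _ e _ he μ g']
  -- the transported test function is continuous with compact support
  set Pm : Matrix (Fin 2) (Fin 2) ℂ := ((Matrix.GeneralLinearGroup.mkOfDetNeZero !![(1 : ℂ), 1; 1, -1] det_cayleyTwo_ne_zero : GL (Fin 2) ℂ) : Matrix (Fin 2) (Fin 2) ℂ) with hPm
  set Pi : Matrix (Fin 2) (Fin 2) ℂ := (((Matrix.GeneralLinearGroup.mkOfDetNeZero !![(1 : ℂ), 1; 1, -1] det_cayleyTwo_ne_zero)⁻¹ : GL (Fin 2) ℂ) : Matrix (Fin 2) (Fin 2) ℂ)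
    with hPi
  have hPiPm : Pi * Pm = 1 := by rw [hPi, hPm, ← Units.val_mul, inv_mul_cancel, Units.val_one]
  have hPmPi : Pm * Pi = 1 := by rw [hPi, hPm, ← Units.val_mul, mul_inv_cancel, Units.val_one]
  have hgP : Continuous fun X : Matrix (Fin 2) (Fin 2) ℂ => g (Pm * X * Pi) := hg.comp ((continuous_const.mul continuous_id).mul continuous_const)
  have hgPc : HasCompactSupport fun X : Matrix (Fin 2) (Fin 2) ℂ => g (Pm * X * Pi) := by
    let φ : Matrix (Fin 2) (Fin 2) ℂ ≃ₜ Matrix (Fin 2) (Fin 2) ℂ :=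
      { toFun := fun X => Pm * X * Pi
        invFun := fun X => Pi * X * Pm
        left_inv := fun X => by
          show Pi * (Pm * X * Pi) * Pm = X
          rw [← Matrix.mul_assoc, ← Matrix.mul_assoc, hPiPm, Matrix.one_mul, Matrix.mul_assoc, hPiPm, Matrix.mul_one]
        right_inv := fun X => by
          show Pm * (Pi * X * Pm) * Pi = X
          rw [← Matrix.mul_assoc, ← Matrix.mul_assoc, hPmPi, Matrix.one_mul, Matrix.mul_assoc, hPmPi, Matrix.mul_one]
        continuous_toFun := (continuous_const.mul continuous_id).mul continuous_const
        continuous_invFun := (continuous_const.mul continuous_id).mul continuous_const }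
    exact hgc.comp_homeomorph φ
  have key := orbitalIntegral_comp_clm ℂ ![(2 : ℂ), -2] w₀ hα (μ.map e.symm) z
    (fun (f : Matrix (Fin 2) (Fin 2) ℂ → E) (ψ : ℝ) => (2 * Real.sin ψ) •
      ∫ h' : ↥(unitaryGroupOfForm (starRingEnd ℂ) ((Matrix.diagonal ![(2 : ℂ), -2]).map (w₀.1.embedding : ℂ →+* ℂ))),
        f (((h' * ⟨circleDiagonal 2 ![z * Circle.exp ψ, z * Circle.exp (-ψ)], circleDiagonal_mem_archLocal_diagonal ℂ 2 ![(2 : ℂ), -2] w₀ _⟩ * h'⁻¹ :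
          ↥(unitaryGroupOfForm (starRingEnd ℂ) ((Matrix.diagonal ![(2 : ℂ), -2]).map (w₀.1.embedding : ℂ →+* ℂ)))) : GL (Fin 2) ℂ) : Matrix (Fin 2) (Fin 2) ℂ) ∂(μ.map e.symm))
    (fun _ _ => rfl)
    (fun (g' : Matrix (Fin 2) (Fin 2) ℂ → E') (ψ : ℝ) => (2 * Real.sin ψ) •
      ∫ h' : ↥(unitaryGroupOfForm (starRingEnd ℂ) ((Matrix.diagonal ![(2 : ℂ), -2]).map (w₀.1.embedding : ℂ →+* ℂ))),
        g' (((h' * ⟨circleDiagonal 2 ![z * Circle.exp ψ, z * Circle.exp (-ψ)], circleDiagonal_mem_archLocal_diagonal ℂ 2 ![(2 : ℂ), -2] w₀ _⟩ * h'⁻¹ :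
          ↥(unitaryGroupOfForm (starRingEnd ℂ) ((Matrix.diagonal ![(2 : ℂ), -2]).map (w₀.1.embedding : ℂ →+* ℂ)))) : GL (Fin 2) ℂ) : Matrix (Fin 2) (Fin 2) ℂ) ∂(μ.map e.symm))
    (fun _ _ => rfl) ℓ hgP hgPc ψ
  rw [hF, hF', htr μ (fun X => ℓ (g X)), htr' g]
  exact key

include hJ in
/-- **`F f` IS `C^∞` ON THE PUNCTURED INTERVAL `Ioo (−1) 1 ∖ {0}`, `U(J)`-Cayley carrier** (`f ∈ C_c^∞`, `μ` finite on compacts): the constant-family case of ★ p851143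
`contDiffOn_cayley_orbitalIntegral_param` (on `|ψ| < 1 < π`, `sin ψ = 0 ↔ ψ = 0`). [cite: Varadarajan1989, §6.4 Thm 24] [cite: Bouaziz1994IntegralesOrbitales, §3.1 (I₂)] -/
theorem contDiffOn_cayley_orbitalIntegral_punctured_of_eq_over (μ : Measure ↥(unitaryGroupOfForm (starRingEnd ℂ) J)) [IsFiniteMeasureOnCompacts μ] (z : Circle)
    (F : (Matrix (Fin 2) (Fin 2) ℂ → E) → ℝ → E)
    (hF : ∀ (f : Matrix (Fin 2) (Fin 2) ℂ → E) (ψ : ℝ), F f ψ = (2 * Real.sin ψ) •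
      ∫ h : ↥(unitaryGroupOfForm (starRingEnd ℂ) J),
        f (((h * ⟨Matrix.GeneralLinearGroup.mkOfDetNeZero !![(1 : ℂ), 1; 1, -1] det_cayleyTwo_ne_zero *
              circleDiagonal 2 ![z * Circle.exp ψ, z * Circle.exp (-ψ)] * (Matrix.GeneralLinearGroup.mkOfDetNeZero !![(1 : ℂ), 1; 1, -1] det_cayleyTwo_ne_zero)⁻¹,
            cayley_conj_circleDiagonal_mem_of_eq_over hJ _⟩ * h⁻¹ : ↥(unitaryGroupOfForm (starRingEnd ℂ) J)) : GL (Fin 2) ℂ) : Matrix (Fin 2) (Fin 2) ℂ) ∂μ)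
    {f : Matrix (Fin 2) (Fin 2) ℂ → E} (hf : ContDiff ℝ ∞ f) (hfc : HasCompactSupport f) :
    ContDiffOn ℝ ∞ (F f) (Ioo (-1 : ℝ) 1 ∩ {(0 : ℝ)}ᶜ) := by
  -- the constant family over the parameter space `ℝ`
  have hΘ : ContDiff ℝ ∞ (Function.uncurry fun (_ : ℝ) (X : Matrix (Fin 2) (Fin 2) ℂ) => f X) := hf.comp contDiff_snd
  have hΘc : ∃ C : Set (Matrix (Fin 2) (Fin 2) ℂ), IsCompact C ∧ ∀ (q : ℝ) (X : Matrix (Fin 2) (Fin 2) ℂ), X ∉ C → (fun (_ : ℝ) (X : Matrix (Fin 2) (Fin 2) ℂ) => f X) q X = 0 :=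
    ⟨tsupport f, hfc, fun _ X hX => image_eq_zero_of_notMem_tsupport hX⟩
  have hjoint := contDiffOn_cayley_orbitalIntegral_param hJ μ z F hF (fun (_ : ℝ) (X : Matrix (Fin 2) (Fin 2) ℂ) => f X) hΘ hΘc
  have hsub : Ioo (-1 : ℝ) 1 ∩ {(0 : ℝ)}ᶜ ⊆ {ψ : ℝ | Real.sin ψ ≠ 0} := fun ψ hψ hs =>
    hψ.2 ((Real.sin_eq_zero_iff_of_lt_of_lt (by linarith [hψ.1.1, Real.pi_gt_three]) (by linarith [hψ.1.2, Real.pi_gt_three])).1 hs)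
  have hmaps : MapsTo (fun ψ : ℝ => ((0 : ℝ), ψ)) (Ioo (-1 : ℝ) 1 ∩ {(0 : ℝ)}ᶜ) ((Set.univ : Set ℝ) ×ˢ {ψ : ℝ | Real.sin ψ ≠ 0}) :=
    fun ψ hψ => Set.mk_mem_prod (Set.mem_univ _) (hsub hψ)
  exact hjoint.comp (contDiff_const.prodMk contDiff_id).contDiffOn hmaps

include hJ in
/-- **JETS COMMUTE WITH CONTINUOUS LINEAR MAPS OFF THE WALL, `U(J)`-Cayley carrier**: `∂ⁿ F(ℓ ∘ g)(ψ) = ℓ(∂ⁿ F′ g (ψ))` for `0 < |ψ| < 1` (`F(ℓ∘g) = ℓ ∘ F′ g` everywhere, `F′ g` is `C^∞`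
near `ψ`, Mathlib `ContinuousLinearMap.iteratedFDeriv_comp_left`). [cite: Varadarajan1989, §6.4 Thm 24] [cite: Bouaziz1994IntegralesOrbitales, §3.1 (I₂) p. 579] -/
theorem iteratedDeriv_cayley_orbitalIntegral_comp_clm_of_eq_over (μ : Measure ↥(unitaryGroupOfForm (starRingEnd ℂ) J)) [IsFiniteMeasureOnCompacts μ] (z : Circle)
    (F : (Matrix (Fin 2) (Fin 2) ℂ → E) → ℝ → E)
    (hF : ∀ (f : Matrix (Fin 2) (Fin 2) ℂ → E) (ψ : ℝ), F f ψ = (2 * Real.sin ψ) •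
      ∫ h : ↥(unitaryGroupOfForm (starRingEnd ℂ) J),
        f (((h * ⟨Matrix.GeneralLinearGroup.mkOfDetNeZero !![(1 : ℂ), 1; 1, -1] det_cayleyTwo_ne_zero *
              circleDiagonal 2 ![z * Circle.exp ψ, z * Circle.exp (-ψ)] * (Matrix.GeneralLinearGroup.mkOfDetNeZero !![(1 : ℂ), 1; 1, -1] det_cayleyTwo_ne_zero)⁻¹,
            cayley_conj_circleDiagonal_mem_of_eq_over hJ _⟩ * h⁻¹ : ↥(unitaryGroupOfForm (starRingEnd ℂ) J)) : GL (Fin 2) ℂ) : Matrix (Fin 2) (Fin 2) ℂ) ∂μ)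
    (F' : (Matrix (Fin 2) (Fin 2) ℂ → E') → ℝ → E')
    (hF' : ∀ (g : Matrix (Fin 2) (Fin 2) ℂ → E') (ψ : ℝ), F' g ψ = (2 * Real.sin ψ) •
      ∫ h : ↥(unitaryGroupOfForm (starRingEnd ℂ) J),
        g (((h * ⟨Matrix.GeneralLinearGroup.mkOfDetNeZero !![(1 : ℂ), 1; 1, -1] det_cayleyTwo_ne_zero *
              circleDiagonal 2 ![z * Circle.exp ψ, z * Circle.exp (-ψ)] * (Matrix.GeneralLinearGroup.mkOfDetNeZero !![(1 : ℂ), 1; 1, -1] det_cayleyTwo_ne_zero)⁻¹,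
            cayley_conj_circleDiagonal_mem_of_eq_over hJ _⟩ * h⁻¹ : ↥(unitaryGroupOfForm (starRingEnd ℂ) J)) : GL (Fin 2) ℂ) : Matrix (Fin 2) (Fin 2) ℂ) ∂μ)
    (ℓ : E' →L[ℝ] E) {g : Matrix (Fin 2) (Fin 2) ℂ → E'} (hg : ContDiff ℝ ∞ g) (hgc : HasCompactSupport g) (n : ℕ) {ψ : ℝ} (hψ : ψ ∈ Ioo (-1 : ℝ) 1) (hψ0 : ψ ≠ 0) :
    iteratedDeriv n (F (fun X => ℓ (g X))) ψ = ℓ (iteratedDeriv n (F' g) ψ) := by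
  have hfun : F (fun X => ℓ (g X)) = ℓ ∘ F' g :=
    funext fun ψ => cayley_orbitalIntegral_comp_clm_of_eq_over hJ μ z F hF F' hF' ℓ hg.continuous hgc ψ
  have hU : IsOpen (Ioo (-1 : ℝ) 1 ∩ {(0 : ℝ)}ᶜ) := isOpen_Ioo.inter isOpen_compl_singleton
  have hcd : ContDiffAt ℝ (n : ℕ∞) (F' g) ψ :=
    (((contDiffOn_cayley_orbitalIntegral_punctured_of_eq_over hJ μ z F' hF' hg hgc).contDiffAt (hU.mem_nhds ⟨hψ, hψ0⟩)).of_le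
      (WithTop.coe_le_coe.2 le_top))
  rw [hfun, iteratedDeriv_eq_iteratedFDeriv, ℓ.iteratedFDeriv_comp_left hcd le_rfl, ContinuousLinearMap.compContinuousMultilinearMap_coe,
    Function.comp_apply, ← iteratedDeriv_eq_iteratedFDeriv]

/-! ## §2 ★ (ELL-∞-UNIF) on `U(J)`: ONE bound near the wall for all CLMs -/

include hJ in
/-- **(ELL-∞-UNIF) ON `U(J)`, CAYLEY TORUS**: for a Haar, right-invariant `μ` on `U(J)`, `g ∈ C_c^∞(M₂(ℂ), E′)` and `n`, there is `B ≥ 0` with `‖∂ⁿ F(ℓ ∘ g)(ψ)‖ ≤ ‖ℓ‖ · B` for all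
`ψ` in ONE punctured neighbourhood of `0` and ALL `ℓ : E′ →L[ℝ] E` — ★ `RankOneCasimir.exists_forall_eventually_norm_iteratedDeriv_orbitalIntegral_comp_clm_le` at the `L := ℂ` instance
of the engine frame (`a = (2,−2)`, `p = q = 1`, Casimir `Ω′` from its formula, Haar `μ.map e⁻¹`), transported along ★ `exists_cayley_transport`. [cite: Varadarajan1989, §6.4 Thm 22]
[cite: Bouaziz1994IntegralesOrbitales, §3.1 (I₁)–(I₂) p. 579] [cite: Rogawski1990, §8.2 p. 122] -/
theorem exists_forall_eventually_norm_iteratedDeriv_cayley_orbitalIntegral_comp_clm_le_of_eq_over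
    (μ : Measure ↥(unitaryGroupOfForm (starRingEnd ℂ) J)) [μ.IsHaarMeasure] [μ.IsMulRightInvariant] (z : Circle)
    (F : (Matrix (Fin 2) (Fin 2) ℂ → E) → ℝ → E)
    (hF : ∀ (f : Matrix (Fin 2) (Fin 2) ℂ → E) (ψ : ℝ), F f ψ = (2 * Real.sin ψ) •
      ∫ h : ↥(unitaryGroupOfForm (starRingEnd ℂ) J),
        f (((h * ⟨Matrix.GeneralLinearGroup.mkOfDetNeZero !![(1 : ℂ), 1; 1, -1] det_cayleyTwo_ne_zero *
              circleDiagonal 2 ![z * Circle.exp ψ, z * Circle.exp (-ψ)] * (Matrix.GeneralLinearGroup.mkOfDetNeZero !![(1 : ℂ), 1; 1, -1] det_cayleyTwo_ne_zero)⁻¹,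
            cayley_conj_circleDiagonal_mem_of_eq_over hJ _⟩ * h⁻¹ : ↥(unitaryGroupOfForm (starRingEnd ℂ) J)) : GL (Fin 2) ℂ) : Matrix (Fin 2) (Fin 2) ℂ) ∂μ)
    {g : Matrix (Fin 2) (Fin 2) ℂ → E'} (hg : ContDiff ℝ ∞ g) (hgc : HasCompactSupport g) (n : ℕ) :
    ∃ B : ℝ, 0 ≤ B ∧ ∀ᶠ ψ in 𝓝[≠] (0 : ℝ), ∀ ℓ : E' →L[ℝ] E, ‖iteratedDeriv n (F (fun X => ℓ (g X))) ψ‖ ≤ ‖ℓ‖ * B := by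
  obtain ⟨w₀⟩ := nonempty_isComplex_infinitePlace_complex
  letI : MeasurableSpace ↥(unitaryGroupOfForm (starRingEnd ℂ) ((Matrix.diagonal ![(2 : ℂ), -2]).map (w₀.1.embedding : ℂ →+* ℂ))) := borel _
  haveI : BorelSpace ↥(unitaryGroupOfForm (starRingEnd ℂ) ((Matrix.diagonal ![(2 : ℂ), -2]).map (w₀.1.embedding : ℂ →+* ℂ))) := ⟨rfl⟩
  obtain ⟨e, he, hγ, htr⟩ := exists_cayley_transport (E := E) hJ w₀
  haveI : (μ.map e.symm).IsHaarMeasure := e.symm.isHaarMeasure_map μ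
  haveI : (μ.map e.symm).IsMulRightInvariant := isMulRightInvariant_map_continuousMulEquiv e.symm μ
  obtain ⟨hα, hreal, hsgn, hqe⟩ := engineFrame_complex w₀
  -- the transported test function `X ↦ g(P X P⁻¹)` is `C_c^∞`
  set Pm : Matrix (Fin 2) (Fin 2) ℂ := ((Matrix.GeneralLinearGroup.mkOfDetNeZero !![(1 : ℂ), 1; 1, -1] det_cayleyTwo_ne_zero : GL (Fin 2) ℂ) : Matrix (Fin 2) (Fin 2) ℂ) with hPm
  set Pi : Matrix (Fin 2) (Fin 2) ℂ := (((Matrix.GeneralLinearGroup.mkOfDetNeZero !![(1 : ℂ), 1; 1, -1] det_cayleyTwo_ne_zero)⁻¹ : GL (Fin 2) ℂ) : Matrix (Fin 2) (Fin 2) ℂ)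
    with hPi
  have hPiPm : Pi * Pm = 1 := by rw [hPi, hPm, ← Units.val_mul, inv_mul_cancel, Units.val_one]
  have hPmPi : Pm * Pi = 1 := by rw [hPi, hPm, ← Units.val_mul, mul_inv_cancel, Units.val_one]
  have hgP : ContDiff ℝ ∞ fun X : Matrix (Fin 2) (Fin 2) ℂ => g (Pm * X * Pi) := hg.comp ((contDiff_const.mul contDiff_id).mul contDiff_const)
  have hgPc : HasCompactSupport fun X : Matrix (Fin 2) (Fin 2) ℂ => g (Pm * X * Pi) := by
    let φ : Matrix (Fin 2) (Fin 2) ℂ ≃ₜ Matrix (Fin 2) (Fin 2) ℂ :=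
      { toFun := fun X => Pm * X * Pi
        invFun := fun X => Pi * X * Pm
        left_inv := fun X => by
          show Pi * (Pm * X * Pi) * Pm = X
          rw [← Matrix.mul_assoc, ← Matrix.mul_assoc, hPiPm, Matrix.one_mul, Matrix.mul_assoc, hPiPm, Matrix.mul_one]
        right_inv := fun X => by
          show Pm * (Pi * X * Pm) * Pi = X
          rw [← Matrix.mul_assoc, ← Matrix.mul_assoc, hPmPi, Matrix.one_mul, Matrix.mul_assoc, hPmPi, Matrix.mul_one]
        continuous_toFun := (continuous_const.mul continuous_id).mul continuous_const
        continuous_invFun := (continuous_const.mul continuous_id).mul continuous_const }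
    exact hgc.comp_homeomorph φ
  -- the transport identity at `E′` and at `E`
  have htr' : ∀ (g' : Matrix (Fin 2) (Fin 2) ℂ → E') (u : Fin 2 → Circle),
      ∫ h : ↥(unitaryGroupOfForm (starRingEnd ℂ) J),
          g' (((h * ⟨Matrix.GeneralLinearGroup.mkOfDetNeZero !![(1 : ℂ), 1; 1, -1] det_cayleyTwo_ne_zero * circleDiagonal 2 u *
                (Matrix.GeneralLinearGroup.mkOfDetNeZero !![(1 : ℂ), 1; 1, -1] det_cayleyTwo_ne_zero)⁻¹, cayley_conj_circleDiagonal_mem_of_eq_over hJ u⟩ * h⁻¹ :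
              ↥(unitaryGroupOfForm (starRingEnd ℂ) J)) : GL (Fin 2) ℂ) : Matrix (Fin 2) (Fin 2) ℂ) ∂μ =
        ∫ h' : ↥(unitaryGroupOfForm (starRingEnd ℂ) ((Matrix.diagonal ![(2 : ℂ), -2]).map (w₀.1.embedding : ℂ →+* ℂ))),
          (fun X : Matrix (Fin 2) (Fin 2) ℂ => g' (Pm * X * Pi))
            (((h' * ⟨circleDiagonal 2 u, circleDiagonal_mem_archLocal_diagonal ℂ 2 ![(2 : ℂ), -2] w₀ u⟩ * h'⁻¹ :
              ↥(unitaryGroupOfForm (starRingEnd ℂ) ((Matrix.diagonal ![(2 : ℂ), -2]).map (w₀.1.embedding : ℂ →+* ℂ)))) : GL (Fin 2) ℂ) : Matrix (Fin 2) (Fin 2) ℂ)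
          ∂(μ.map e.symm) := fun g' u => by
    rw [hγ u, integral_comp_conj_transport _ _ e _ he μ g']
  -- the engine statement at `E′`, for the transported test function
  obtain ⟨B, hB0, hB⟩ := exists_forall_eventually_norm_iteratedDeriv_orbitalIntegral_comp_clm_le (E := E) (E' := E') ℂ ![(2 : ℂ), -2] w₀ hα hreal hsgn
    (p := 1) (q := 1) (by norm_num) hqe (μ.map e.symm)
    (fun g' Y =>
      -(fderiv ℝ (fderiv ℝ g') Y (Y * !![I, 0; 0, -I]) (Y * !![I, 0; 0, -I]) + fderiv ℝ g' Y (Y * !![I, 0; 0, -I] * !![I, 0; 0, -I])) +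
        (fderiv ℝ (fderiv ℝ g') Y (Y * !![(0 : ℂ), ((1 : ℝ) : ℂ); ((1 : ℝ) : ℂ), 0]) (Y * !![(0 : ℂ), ((1 : ℝ) : ℂ); ((1 : ℝ) : ℂ), 0]) +
          fderiv ℝ g' Y (Y * !![(0 : ℂ), ((1 : ℝ) : ℂ); ((1 : ℝ) : ℂ), 0] * !![(0 : ℂ), ((1 : ℝ) : ℂ); ((1 : ℝ) : ℂ), 0])) +
        (fderiv ℝ (fderiv ℝ g') Y (Y * !![(0 : ℂ), -(((1 : ℝ) : ℂ) * I); ((1 : ℝ) : ℂ) * I, 0]) (Y * !![(0 : ℂ), -(((1 : ℝ) : ℂ) * I); ((1 : ℝ) : ℂ) * I, 0]) +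
          fderiv ℝ g' Y (Y * !![(0 : ℂ), -(((1 : ℝ) : ℂ) * I); ((1 : ℝ) : ℂ) * I, 0] * !![(0 : ℂ), -(((1 : ℝ) : ℂ) * I); ((1 : ℝ) : ℂ) * I, 0])))
    (fun _ _ => rfl) z
    (fun (f : Matrix (Fin 2) (Fin 2) ℂ → E) (ψ : ℝ) => (2 * Real.sin ψ) •
      ∫ h' : ↥(unitaryGroupOfForm (starRingEnd ℂ) ((Matrix.diagonal ![(2 : ℂ), -2]).map (w₀.1.embedding : ℂ →+* ℂ))),
        f (((h' * ⟨circleDiagonal 2 ![z * Circle.exp ψ, z * Circle.exp (-ψ)], circleDiagonal_mem_archLocal_diagonal ℂ 2 ![(2 : ℂ), -2] w₀ _⟩ * h'⁻¹ :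
          ↥(unitaryGroupOfForm (starRingEnd ℂ) ((Matrix.diagonal ![(2 : ℂ), -2]).map (w₀.1.embedding : ℂ →+* ℂ)))) : GL (Fin 2) ℂ) : Matrix (Fin 2) (Fin 2) ℂ) ∂(μ.map e.symm))
    (fun _ _ => rfl)
    (fun (g' : Matrix (Fin 2) (Fin 2) ℂ → E') (ψ : ℝ) => (2 * Real.sin ψ) •
      ∫ h' : ↥(unitaryGroupOfForm (starRingEnd ℂ) ((Matrix.diagonal ![(2 : ℂ), -2]).map (w₀.1.embedding : ℂ →+* ℂ))),
        g' (((h' * ⟨circleDiagonal 2 ![z * Circle.exp ψ, z * Circle.exp (-ψ)], circleDiagonal_mem_archLocal_diagonal ℂ 2 ![(2 : ℂ), -2] w₀ _⟩ * h'⁻¹ :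
          ↥(unitaryGroupOfForm (starRingEnd ℂ) ((Matrix.diagonal ![(2 : ℂ), -2]).map (w₀.1.embedding : ℂ →+* ℂ)))) : GL (Fin 2) ℂ) : Matrix (Fin 2) (Fin 2) ℂ) ∂(μ.map e.symm))
    (fun _ _ => rfl) hgP hgPc n
  refine ⟨B, hB0, ?_⟩
  filter_upwards [hB] with ψ hψ ℓ
  -- `F (ℓ ∘ g)` on `U(J)` IS the engine functional of `ℓ ∘ (g ∘ Ad_P)`
  have hfun : F (fun X => ℓ (g X)) = fun ψ => (2 * Real.sin ψ) •
      ∫ h' : ↥(unitaryGroupOfForm (starRingEnd ℂ) ((Matrix.diagonal ![(2 : ℂ), -2]).map (w₀.1.embedding : ℂ →+* ℂ))),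
        (fun X => ℓ ((fun X : Matrix (Fin 2) (Fin 2) ℂ => g (Pm * X * Pi)) X))
          (((h' * ⟨circleDiagonal 2 ![z * Circle.exp ψ, z * Circle.exp (-ψ)], circleDiagonal_mem_archLocal_diagonal ℂ 2 ![(2 : ℂ), -2] w₀ _⟩ * h'⁻¹ :
            ↥(unitaryGroupOfForm (starRingEnd ℂ) ((Matrix.diagonal ![(2 : ℂ), -2]).map (w₀.1.embedding : ℂ →+* ℂ)))) : GL (Fin 2) ℂ) : Matrix (Fin 2) (Fin 2) ℂ) ∂(μ.map e.symm) := by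
    funext ψ'
    rw [hF, htr μ (fun X => ℓ (g X))]
  rw [hfun]
  exact hψ ℓ

/-! ## §3 HEAD: the FIXED punctured interval `Icc (−½) ½ ∖ {0}` -/

include hJ in
/-- **THE FIXED-INTERVAL `hunif` ON `U(J)`**: for a Haar, right-invariant `μ`, `g ∈ C_c^∞(M₂(ℂ), E′)` and `n` there is ONE `B` with
**`‖∂ⁿ F(ℓ ∘ g)(ψ)‖ ≤ ‖ℓ‖ · B` for ALL `ψ ∈ Icc (−½) ½`, `ψ ≠ 0`, and ALL `ℓ : E′ →L[ℝ] E`** (§2 on a punctured ball `0 < |ψ| < δ`; on the compact annulus `δ∕2 ≤ |ψ| ≤ ½` the `E′`-jet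
`∂ⁿ F′ g` is continuous (§1) hence bounded, and `∂ⁿ F(ℓ∘g) = ℓ(∂ⁿ F′ g)` there (§1)) — the `hunif` of ★ `exists_forall_norm_iteratedDeriv_le_of_uniform_bounds_on` (F0P3a-p02) at any `E′`.
[cite: Varadarajan1989, §6.4 Thms 22–24] [cite: Bouaziz1994IntegralesOrbitales, §3.1 (I₁)–(I₂) p. 579] -/
theorem exists_forall_norm_iteratedDeriv_cayley_orbitalIntegral_comp_clm_le_of_mem_Icc
    (μ : Measure ↥(unitaryGroupOfForm (starRingEnd ℂ) J)) [μ.IsHaarMeasure] [μ.IsMulRightInvariant] (z : Circle)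
    (F : (Matrix (Fin 2) (Fin 2) ℂ → E) → ℝ → E)
    (hF : ∀ (f : Matrix (Fin 2) (Fin 2) ℂ → E) (ψ : ℝ), F f ψ = (2 * Real.sin ψ) •
      ∫ h : ↥(unitaryGroupOfForm (starRingEnd ℂ) J),
        f (((h * ⟨Matrix.GeneralLinearGroup.mkOfDetNeZero !![(1 : ℂ), 1; 1, -1] det_cayleyTwo_ne_zero *
              circleDiagonal 2 ![z * Circle.exp ψ, z * Circle.exp (-ψ)] * (Matrix.GeneralLinearGroup.mkOfDetNeZero !![(1 : ℂ), 1; 1, -1] det_cayleyTwo_ne_zero)⁻¹,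
            cayley_conj_circleDiagonal_mem_of_eq_over hJ _⟩ * h⁻¹ : ↥(unitaryGroupOfForm (starRingEnd ℂ) J)) : GL (Fin 2) ℂ) : Matrix (Fin 2) (Fin 2) ℂ) ∂μ)
    (F' : (Matrix (Fin 2) (Fin 2) ℂ → E') → ℝ → E')
    (hF' : ∀ (g : Matrix (Fin 2) (Fin 2) ℂ → E') (ψ : ℝ), F' g ψ = (2 * Real.sin ψ) •
      ∫ h : ↥(unitaryGroupOfForm (starRingEnd ℂ) J),
        g (((h * ⟨Matrix.GeneralLinearGroup.mkOfDetNeZero !![(1 : ℂ), 1; 1, -1] det_cayleyTwo_ne_zero *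
              circleDiagonal 2 ![z * Circle.exp ψ, z * Circle.exp (-ψ)] * (Matrix.GeneralLinearGroup.mkOfDetNeZero !![(1 : ℂ), 1; 1, -1] det_cayleyTwo_ne_zero)⁻¹,
            cayley_conj_circleDiagonal_mem_of_eq_over hJ _⟩ * h⁻¹ : ↥(unitaryGroupOfForm (starRingEnd ℂ) J)) : GL (Fin 2) ℂ) : Matrix (Fin 2) (Fin 2) ℂ) ∂μ)
    {g : Matrix (Fin 2) (Fin 2) ℂ → E'} (hg : ContDiff ℝ ∞ g) (hgc : HasCompactSupport g) (n : ℕ) :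
    ∃ B : ℝ, ∀ ψ ∈ Icc (-(1 / 2 : ℝ)) (1 / 2) ∩ {(0 : ℝ)}ᶜ, ∀ ℓ : E' →L[ℝ] E, ‖iteratedDeriv n (F (fun X => ℓ (g X))) ψ‖ ≤ ‖ℓ‖ * B := by
  -- near the wall: §2
  obtain ⟨B₀, -, hB₀⟩ := exists_forall_eventually_norm_iteratedDeriv_cayley_orbitalIntegral_comp_clm_le_of_eq_over (E := E) hJ μ z F hF hg hgc n
  obtain ⟨V, hV, hVsub⟩ : ∃ V ∈ 𝓝 (0 : ℝ), ∀ ψ ∈ V ∩ {(0 : ℝ)}ᶜ, ∀ ℓ : E' →L[ℝ] E, ‖iteratedDeriv n (F (fun X => ℓ (g X))) ψ‖ ≤ ‖ℓ‖ * B₀ := by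
    obtain ⟨V, hV, hVs⟩ := mem_nhdsWithin_iff_exists_mem_nhds_inter.1 hB₀
    exact ⟨V, hV, fun ψ hψ => hVs hψ⟩
  obtain ⟨δ, hδ, hδV⟩ := Metric.mem_nhds_iff.1 hV
  -- away from the wall: continuity of the `E′`-jet on the compact annulus `A = Icc (−½) ½ ∖ ball 0 δ`
  have hU : IsOpen (Ioo (-1 : ℝ) 1 ∩ {(0 : ℝ)}ᶜ) := isOpen_Ioo.inter isOpen_compl_singleton
  have hsmooth := contDiffOn_cayley_orbitalIntegral_punctured_of_eq_over hJ μ z F' hF' hg hgc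
  have hcont : ContinuousOn (iteratedDeriv n (F' g)) (Ioo (-1 : ℝ) 1 ∩ {(0 : ℝ)}ᶜ) := by
    have h := hsmooth.continuousOn_iteratedDerivWithin (m := n) (mod_cast le_top) hU.uniqueDiffOn
    exact h.congr fun ψ hψ => (iteratedDerivWithin_of_isOpen hU hψ).symm
  set A : Set ℝ := Icc (-(1 / 2 : ℝ)) (1 / 2) \ Metric.ball 0 δ with hA
  have hAc : IsCompact A := isCompact_Icc.diff Metric.isOpen_ball
  have hAsub : A ⊆ Ioo (-1 : ℝ) 1 ∩ {(0 : ℝ)}ᶜ := by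
    intro ψ hψ
    refine ⟨⟨by linarith [hψ.1.1], by linarith [hψ.1.2]⟩, fun h0 => hψ.2 ?_⟩
    rw [Set.mem_singleton_iff.1 h0]
    exact Metric.mem_ball_self hδ
  obtain ⟨B₁, hB₁⟩ := hAc.exists_bound_of_continuousOn (hcont.mono hAsub)
  refine ⟨max B₀ B₁, fun ψ hψ ℓ => ?_⟩
  by_cases hψδ : ψ ∈ Metric.ball (0 : ℝ) δ
  · exact (hVsub ψ ⟨hδV hψδ, hψ.2⟩ ℓ).trans (mul_le_mul_of_nonneg_left (le_max_left _ _) (norm_nonneg _))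
  · have hψA : ψ ∈ A := ⟨hψ.1, hψδ⟩
    have hψU := hAsub hψA
    rw [iteratedDeriv_cayley_orbitalIntegral_comp_clm_of_eq_over hJ μ z F hF F' hF' ℓ hg hgc n hψU.1 hψU.2]
    exact (ℓ.le_opNorm _).trans (mul_le_mul_of_nonneg_left ((hB₁ ψ hψA).trans (le_max_right _ _)) (norm_nonneg _))

end UnitaryGroup

end Literature.NumberTheory.Automorphic

end
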